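import Mathlib
import HarnessLib

/-!
# Stars and bars for `Finset.Nat.antidiagonalTuple`: counting multi-indices by degree

`Literature/Combinatorics/Enumerative/AntidiagonalTupleCard.lean`. Everything here is PROVED (no
definition, no named fact). Mathlib's `Finset.Nat.antidiagonalTuple k n` is the finset of `k`-tuples
of natural numbers summing to `n`; we supply its cardinality — the "stars and bars" count

  `#{x : Fin (k+1) → ℕ | ∑ x = n} = C(n + k, k)`  (`card_antidiagonalTuple_succ`),

and the count of multi-indices in `k + 1` variables of total degree `< α`,

  `#{(n, x) | n < α, ∑ x = n} = C(α + k, k + 1)`  (`card_sigma_range_antidiagonalTuple`).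

This is the count "`binom(α + d, d) ∼ αᵈ/d!` linear equations" of the auxiliary construction
(Siegel lemma) in F. Calegari, V. Dimitrov, Y. Tang, *The unbounded denominators conjecture*
(J. Amer. Math. Soc. **38** (2025), 627–702; arXiv:2109.09040), §2.1, proof of Lemma 2.1.1: "We
expand our sought-for formal function … into a formal power series in `ℚ⟦x⟧` and solve
`binom(α + d, d) ∼ αᵈ/d!` linear equations in the `(mD)ᵈ` free parameters `a_{i,j}`" (the
vanishing of all monomials of total degree `< α` in `d` variables).

## References

* [CalegariDimitrovTang2025] F. Calegari, V. Dimitrov, Y. Tang, The unbounded denominators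
  conjecture, J. Amer. Math. Soc. 38 (2025), no. 3, 627–702, §2.1, proof of Lemma 2.1.1;
  arXiv:2109.09040.
-/

namespace Literature.Combinatorics.Enumerative

open Finset

/-- **Stars and bars** for lists: the number of `(k+1)`-tuples of natural numbers with sum `n` is
`C(n + k, k)` (recursion of `List.Nat.antidiagonalTuple` and the hockey-stick identity
`Finset.sum_antidiagonal_choose_add`). [folklore] -/
theorem length_antidiagonalTuple_succ (k n : ℕ) :
    (List.Nat.antidiagonalTuple (k + 1) n).length = (n + k).choose k := by
  induction k generalizing n with
  | zero => simp [List.Nat.antidiagonalTuple_one]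
  | succ k ih =>
    rw [List.Nat.antidiagonalTuple, List.length_flatMap]
    simp only [List.length_map, ih]
    have h := Finset.sum_antidiagonal_choose_add k n
    rw [Finset.sum_eq_multiset_sum] at h
    change (Multiset.map (fun ij : ℕ × ℕ ↦ (k + ij.2).choose k)
      (List.Nat.antidiagonal n : Multiset (ℕ × ℕ))).sum = _ at h
    rw [Multiset.map_coe, Multiset.sum_coe] at h
    have hfun : (fun ij : ℕ × ℕ ↦ (ij.2 + k).choose k) = fun ij : ℕ × ℕ ↦ (k + ij.2).choose k := by
      funext ij; rw [add_comm]
    rw [hfun, h]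
    congr 1; omega

/-- **Stars and bars**: `(Finset.Nat.antidiagonalTuple (k+1) n).card = C(n + k, k)` — the number
of monomials of degree exactly `n` in `k + 1` variables. [folklore] -/
theorem card_antidiagonalTuple_succ (k n : ℕ) :
    (Finset.Nat.antidiagonalTuple (k + 1) n).card = (n + k).choose k := by
  rw [← length_antidiagonalTuple_succ k n]
  rfl

/-- The number of multi-indices in `k + 1` variables of total degree `< α`:
`#((range α).sigma (antidiagonalTuple (k+1))) = C(α + k, k + 1)` — the number of monomials of
degree `< α` in `k + 1` variables, i.e. the number of linear equations "vanishing to order `≥ α`"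
in CDT's auxiliary construction. [cite: CalegariDimitrovTang2025, §2.1, proof of Lemma 2.1.1] -/
theorem card_sigma_range_antidiagonalTuple (k α : ℕ) :
    ((range α).sigma fun n ↦ Finset.Nat.antidiagonalTuple (k + 1) n).card =
      (α + k).choose (k + 1) := by
  rw [card_sigma]
  simp only [card_antidiagonalTuple_succ]
  rcases Nat.eq_zero_or_pos α with hα | hα
  · subst hα
    rw [sum_range_zero, zero_add, Nat.choose_eq_zero_of_lt (Nat.lt_succ_self k)]
  · obtain ⟨m, rfl⟩ := Nat.exists_eq_succ_of_ne_zero hα.ne'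
    rw [Nat.succ_eq_add_one, Nat.sum_range_add_choose m k]
    congr 1
    omega

/-- The multi-indices of degree `< α` are exactly the tuples `x : Fin (k+1) → ℕ` with `∑ x < α`
(membership form of `card_sigma_range_antidiagonalTuple`). [folklore] -/
theorem mem_sigma_range_antidiagonalTuple {k α : ℕ} {p : Σ _ : ℕ, Fin (k + 1) → ℕ} :
    p ∈ (range α).sigma (fun n ↦ Finset.Nat.antidiagonalTuple (k + 1) n) ↔
      p.1 < α ∧ ∑ i, p.2 i = p.1 := by
  rw [mem_sigma, mem_range, Finset.Nat.mem_antidiagonalTuple]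

end Literature.Combinatorics.Enumerative
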